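import Literature.AlgebraicTopology.SingularHomology.CechNerveFunctionsExact
import Literature.Algebra.Homology.GroupCohomologyFreeOrbitFunctions
import Literature.Algebra.Homology.GroupCohomologyCoresolutionFiniteExact
import Mathlib.Topology.Algebra.ConstMulAction
import HarnessLib

/-!
# Brown's finiteness criterion from an invariant good cover (finite coefficients, torsion allowed)

Topic `Algebra/Homology`; namespace `Literature.Algebra.Homology`.  Definitions with body (an
index type, a `Prop`-valued mixin class, one `MulAction` instance on the nerve, one morphism of
representations) and theorems; no named fact, no `sorry`.

Let a group `S` act by homeomorphisms on a CONTRACTIBLE space `X`, and let `𝔘 = (U_i)_{i ∈ ι}` be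
an open cover indexed by an `S`-SET `ι` with `U_{g i} = g U_i` (`IsInvariantFamily`), all of whose
non-empty finite intersections are contractible.  Then `S` acts on the nerve `N_p(𝔘)` and the
exact complex of functions `0 → A → Fun(N₀, A) → Fun(N₁, A) → ⋯`
(`Literature/AlgebraicTopology/SingularHomology/CechNerveFunctionsExact`) is a complex of
representations (`cechRepD`, diagonal action) — the cochain CORESOLUTION of `A` attached to the
`S`-complex `N(𝔘)` ([Brown1982CohomologyGroups, VII §4, §7]).  By dimension shifting
(`finite_groupCohomology_of_exact_sequence`, the finiteness half of Brown's criterion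
[Brown1982CohomologyGroups, VII (7.10)]):

* `finite_groupCohomology_of_invariantGoodCover` — if every `Hⁿ(S, Fun(N_p, A))` is finite then
  every `Hⁿ(S, A)` is finite;
* `finite_groupCohomology_of_translateCover` — **the form used for arithmetic groups**: finitely
  many open PROTOTYPES `V_b ⊆ X` whose translates `g V_b` cover `X`, all non-empty finite
  intersections of translates contractible (e.g. the `V_b` convex in a model in which `S` acts by
  convexity-preserving maps), and PAIRWISE LOCAL FINITENESS `#{g | g V_b ∩ V_{b'} ≠ ∅} < ∞`.  The
  cover is indexed by the FREE `S`-set `S × B` (`TIdx`), so the nerve is a free `S`-set with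
  finitely many orbits in each degree whatever the torsion of `S` or the kernel of the action,
  `Fun(N_p, A) ≅ Coind_1^S Fun(T_p, A)` (`GroupCohomologyFreeOrbitFunctions`), and
  **`Hⁿ(S, A)` is finite for every finite `A` and every `n`**.

Compared with [BorelSerre1973, §11.1] (torsion-free arithmetic groups are of type (FL) via an
equivariant triangulation of the bordification) this trades the free resolution for a cochain
coresolution by coinduced modules: no triangulation, no torsion-freeness and no compact quotient
are needed — only contractibility, an equivariant good cover by translates of finitely many
prototypes, and local finiteness.

## References

* K. S. Brown, *Cohomology of Groups*, GTM 87 (1982), VII §4 (equivariant homology of a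
  `G`-complex), VII §7 (7.10), VIII §2 [Brown1982CohomologyGroups].
* A. Borel, J.-P. Serre, *Corners and arithmetic groups*, Comment. Math. Helv. 48 (1973), §11.1
  [BorelSerre1973].
-/

noncomputable section

open CategoryTheory groupCohomology
open Literature.AlgebraicTopology.SingularHomology
open Literature.AlgebraicTopology.SingularHomology.CechNerve
open scoped Pointwise

universe u

namespace Literature.Algebra.Homology

variable {k : Type u} [CommRing k] {S : Type u} [Group S] {X : Type u} [MulAction S X]

/-! ### Invariant families and the action on the nerve -/

/-- **An `S`-invariant family of subsets indexed by an `S`-set**: `U_{g • i} = g • U_i`.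
(A `Prop`-valued mixin, so that the nerve of `U` inherits a `MulAction` instance.)
[cite: Brown1982CohomologyGroups, VII §4] -/
class IsInvariantFamily (S : Type u) [Group S] {X : Type u} [MulAction S X] {ι : Type u}
    [MulAction S ι] (U : ι → Set X) : Prop where
  /-- invariance -/
  smul_eq : ∀ (g : S) (i : ι), U (g • i) = g • U i

section Invariant

variable {ι : Type u} [MulAction S ι] (U : ι → Set X) [IsInvariantFamily S U]

/-- Finite intersections of an invariant family are permuted: `U_{g • J} = g • U_J`. [folklore] -/
theorem cechSet_smul (g : S) {n : ℕ} (J : Fin n → ι) : cechSet U (g • J) = g • cechSet U J := by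
  ext x
  rw [mem_cechSet_iff, Set.mem_smul_set_iff_inv_smul_mem, mem_cechSet_iff]
  refine forall_congr' fun i => ?_
  rw [Pi.smul_apply, IsInvariantFamily.smul_eq (S := S) (U := U), Set.mem_smul_set_iff_inv_smul_mem]

/-- **The action of `S` on the nerve of an invariant family**, `(g • J)(k) = g • J(k)`.
[cite: Brown1982CohomologyGroups, VII §4] -/
instance Nerve.instMulAction (p : ℕ) : MulAction S (Nerve U p) where
  smul g J := ⟨g • J.1, by rw [cechSet_smul]; exact J.2.smul_set⟩
  one_smul J := Subtype.ext (one_smul S J.1)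
  mul_smul g h J := Subtype.ext (mul_smul g h J.1)

/-- The underlying tuple of `g • J`. [folklore] -/
@[simp]
theorem Nerve.coe_smul {p : ℕ} (g : S) (J : Nerve U p) : (g • J).1 = g • J.1 :=
  rfl

/-- Faces are equivariant. [folklore] -/
theorem Nerve.face_smul {p : ℕ} (g : S) (j : Fin (p + 2)) (J : Nerve U (p + 1)) :
    Nerve.face j (g • J) = g • Nerve.face j J :=
  Subtype.ext rfl

variable (A : Rep.{u} k S)

/-- **The Čech differential is a morphism of representations** `Fun(N_p, A) ⟶ Fun(N_{p+1}, A)`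
for the diagonal actions (faces are equivariant). [cite: Brown1982CohomologyGroups, VII §7] -/
def cechRepD (p : ℕ) : funRep A (Nerve U p) ⟶ funRep A (Nerve U (p + 1)) :=
  Rep.ofHom
    { toLinearMap := cechFunD k A U p
      isIntertwining' := fun g => by
        refine LinearMap.ext fun f => funext fun J => ?_
        change cechFunD k A U p (funRepr A.ρ (Nerve U p) g f) J =
          A.ρ g (cechFunD k A U p f (g⁻¹ • J))
        rw [cechFunD_apply, cechFunD_apply, map_sum]
        refine Finset.sum_congr rfl fun j _ => ?_
        rw [map_smul, funRepr_apply, Nerve.face_smul] }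

/-- The underlying linear map of `cechRepD` is `cechFunD`. [folklore] -/
theorem cechRepD_hom_apply (p : ℕ) (f : funRep A (Nerve U p)) :
    (cechRepD U A p).hom f = cechFunD k A U p f :=
  rfl

/-- **Brown's finiteness criterion from an invariant good cover.**  Let `S` act by homeomorphisms
on a contractible space `X` covered by an invariant family of open sets all of whose non-empty
finite intersections are contractible.  If `Hⁿ(S, Fun(N_p(𝔘), A))` is finite for all `p, n`, then
`Hⁿ(S, A)` is finite for all `n`: the Čech complex `0 → A → Fun(N₀, A) → Fun(N₁, A) → ⋯` is an
exact coresolution in `Rep k S` (`cechFunCoaug_exact`, `cechFunD_exact_succ`), and dimension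
shifting applies (`finite_groupCohomology_of_exact_sequence`).
[cite: Brown1982CohomologyGroups, VII (7.10); VII §4] -/
theorem finite_groupCohomology_of_invariantGoodCover [TopologicalSpace X] [ContractibleSpace X]
    (hU : ∀ i, IsOpen (U i)) (hcov : (Set.univ : Set X) ⊆ ⋃ i, U i)
    (hgood : ∀ (p : ℕ) (J : Fin (p + 1) → ι), (cechSet U J).Nonempty → ContractibleSpace ↥(cechSet U J))
    (hW : ∀ p n, Finite (groupCohomology (funRep A (Nerve U p)) n)) (n : ℕ) :
    Finite (groupCohomology A n) := by
  haveI : Nonempty X := inferInstance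
  exact finite_groupCohomology_of_exact_sequence A (fun p => funRep A (Nerve U p))
    (funRepConst A (Nerve U 0)) (fun p => cechRepD U A p)
    (cechFunCoaug_injective (R := k) (M := A) (U := U) hcov)
    (cechFunCoaug_exact (R := k) (M := A) (U := U) hU hcov)
    (fun p => cechFunD_exact_succ (R := k) (M := A) (U := U) hU hcov hgood p) hW n

end Invariant

/-! ### Covers by translates of finitely many prototypes -/

/-- **Translate indices** `S × B` with `S` acting by left multiplication on the first factor
(a FREE `S`-set, whatever the torsion of `S`). [folklore] -/
@[ext]
structure TIdx (S : Type u) (B : Type u) where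
  /-- the translating element -/
  g : S
  /-- the prototype -/
  b : B

namespace TIdx

variable {B : Type u}

/-- `S` acts on translate indices by left multiplication. [folklore] -/
instance instMulAction : MulAction S (TIdx S B) where
  smul g i := ⟨g * i.g, i.b⟩
  one_smul i := TIdx.ext (one_mul i.g) rfl
  mul_smul g h i := TIdx.ext (mul_assoc g h i.g) rfl

/-- The translating element of `g • i`. [folklore] -/
@[simp]
theorem smul_g (g : S) (i : TIdx S B) : (g • i).g = g * i.g :=
  rfl

/-- The prototype of `g • i`. [folklore] -/
@[simp]
theorem smul_b (g : S) (i : TIdx S B) : (g • i).b = i.b :=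
  rfl

end TIdx

section Translate

variable {B : Type u} (V : B → Set X)

/-- **The family of translates** `U_{(g, b)} = g • V_b` of the prototypes `V_b`. [folklore] -/
def translCover : TIdx S B → Set X := fun i => i.g • V i.b

/-- Unfolding lemma for `translCover`. [folklore] -/
@[simp]
theorem translCover_apply (i : TIdx S B) : translCover V i = i.g • V i.b :=
  rfl

/-- The family of translates is invariant. [folklore] -/
instance translCover.isInvariantFamily : IsInvariantFamily S (translCover (S := S) V) where
  smul_eq g i := by rw [translCover_apply, translCover_apply, TIdx.smul_g, TIdx.smul_b, mul_smul]

/-- Orbit representatives in the nerve of the translates: simplices whose first vertex has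
translating element `1`. [folklore] -/
abbrev NerveRep (p : ℕ) : Type u :=
  {J : Nerve (translCover (S := S) V) p // (J.1 0).g = 1}

/-- **The nerve of the translates is a free `S`-set with section the representatives**:
`(g, J) ↦ g • J` is a bijection `S × NerveRep ≃ Nerve`. [folklore] -/
theorem nerve_bijective (p : ℕ) :
    Function.Bijective fun q : S × NerveRep (S := S) V p => q.1 • (q.2 : Nerve (translCover (S := S) V) p) := by
  constructor
  · rintro ⟨g, J⟩ ⟨g', J'⟩ h
    change g • (J : Nerve (translCover (S := S) V) p) = g' • (J' : Nerve (translCover (S := S) V) p) at h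
    have hg : g = g' := by
      have h0 := congrArg (fun K : Nerve (translCover (S := S) V) p => (K.1 0).g) h
      change (g • (J.1.1 0)).g = (g' • (J'.1.1 0)).g at h0
      rw [TIdx.smul_g, TIdx.smul_g, J.2, J'.2, mul_one, mul_one] at h0
      exact h0
    subst hg
    have hJ : (J : Nerve (translCover (S := S) V) p) = J' := smul_left_cancel g h
    rw [Subtype.ext hJ]
  · intro J
    refine ⟨((J.1 0).g, ⟨(J.1 0).g⁻¹ • J, ?_⟩), ?_⟩
    · change ((J.1 0).g⁻¹ • J.1 0).g = 1
      rw [TIdx.smul_g, inv_mul_cancel]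
    · change (J.1 0).g • ((J.1 0).g⁻¹ • J) = J
      rw [smul_inv_smul]

/-- The set of translate indices meeting some prototype is finite under pairwise local
finiteness. [folklore] -/
theorem finite_meeting [Finite B] (hfin : ∀ b b' : B, {g : S | (g • V b ∩ V b').Nonempty}.Finite) :
    {i : TIdx S B | ∃ b', (i.g • V i.b ∩ V b').Nonempty}.Finite := by
  have h : {i : TIdx S B | ∃ b', (i.g • V i.b ∩ V b').Nonempty} ⊆
      ⋃ b : B, ⋃ b' : B, (fun g : S => (⟨g, b⟩ : TIdx S B)) '' {g : S | (g • V b ∩ V b').Nonempty} := by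
    rintro ⟨g, b⟩ ⟨b', hb'⟩
    exact Set.mem_iUnion.2 ⟨b, Set.mem_iUnion.2 ⟨b', ⟨g, hb', rfl⟩⟩⟩
  exact Set.Finite.subset (Set.finite_iUnion fun b => Set.finite_iUnion fun b' =>
    (hfin b b').image _) h

/-- **Finitely many orbit representatives in each degree** under pairwise local finiteness: a
representative simplex `J` (`(J 0).g = 1`) has all its vertices `(g_k, b_k)` with
`g_k V_{b_k} ∩ V_{b_0} ≠ ∅`. [cite: Brown1982CohomologyGroups, VII §7] -/
theorem finite_nerveRep [Finite B] (hfin : ∀ b b' : B, {g : S | (g • V b ∩ V b').Nonempty}.Finite)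
    (p : ℕ) : Finite (NerveRep (S := S) V p) := by
  set F : Set (TIdx S B) := {i : TIdx S B | ∃ b', (i.g • V i.b ∩ V b').Nonempty} with hF
  haveI : Finite F := (finite_meeting V hfin).to_subtype
  have hmem : ∀ (J : NerveRep (S := S) V p) (m : Fin (p + 1)), J.1.1 m ∈ F := by
    intro J m
    obtain ⟨x, hx⟩ := J.1.2
    refine ⟨(J.1.1 0).b, x, ?_, ?_⟩
    · exact (mem_cechSet_iff).1 hx m
    · have h0 := (mem_cechSet_iff).1 hx 0
      rw [translCover_apply, J.2, one_smul] at h0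
      exact h0
  refine Finite.of_injective (fun J : NerveRep (S := S) V p => fun m : Fin (p + 1) =>
    (⟨J.1.1 m, hmem J m⟩ : F)) ?_
  intro J J' h
  apply Subtype.ext
  apply Subtype.ext
  funext m
  exact congrArg Subtype.val (congrFun h m)

/-- **Brown's finiteness criterion for a cover by translates of finitely many prototypes.**  Let
`S` act by homeomorphisms on a contractible space `X`; let `V_b` (`b ∈ B`, finite) be open subsets
whose translates `g V_b` cover `X`, such that every non-empty finite intersection of translates is
contractible, and such that for all `b, b'` only finitely many `g` have `g V_b ∩ V_{b'} ≠ ∅`.  Then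
`Hⁿ(S, A)` is finite for every representation `A` of `S` with finitely many elements and every
`n` — the nerve of the translates is a free `S`-set with finitely many orbits in each degree, so
`Hⁿ(S, Fun(N_p, A)) ≅ Hⁿ(1, Fun(T_p, A))` is finite (`finite_groupCohomology_funRep_of_free`), and
`finite_groupCohomology_of_invariantGoodCover` applies.  No freeness of the action on `X`, no
torsion-freeness of `S` and no compactness of a quotient are required.
[cite: Brown1982CohomologyGroups, VII (7.10); VIII §2] -/
theorem finite_groupCohomology_of_translateCover [TopologicalSpace X] [ContinuousConstSMul S X]
    [ContractibleSpace X] [Finite B] (hV : ∀ b, IsOpen (V b))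
    (hcov : ∀ x : X, ∃ (g : S) (b : B), x ∈ g • V b)
    (hgood : ∀ (p : ℕ) (J : Fin (p + 1) → TIdx S B),
      (cechSet (translCover (S := S) V) J).Nonempty → ContractibleSpace ↥(cechSet (translCover (S := S) V) J))
    (hfin : ∀ b b' : B, {g : S | (g • V b ∩ V b').Nonempty}.Finite)
    (A : Rep.{u} k S) [Finite A] (n : ℕ) : Finite (groupCohomology A n) := by
  refine finite_groupCohomology_of_invariantGoodCover (translCover (S := S) V) A
    (fun i => (hV i.b).smul i.g) (fun x _ => ?_) hgood (fun p m => ?_) n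
  · obtain ⟨g, b, hx⟩ := hcov x
    exact Set.mem_iUnion.2 ⟨⟨g, b⟩, hx⟩
  · haveI := finite_nerveRep V hfin p
    exact finite_groupCohomology_funRep_of_free A (Nerve (translCover (S := S) V) p)
      (fun J : NerveRep (S := S) V p => (J : Nerve (translCover (S := S) V) p)) (nerve_bijective V p) m

end Translate

end Literature.Algebra.Homology
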